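import Literature.NumberTheory.LFunctions.WeilCombDifferenceSums
import Literature.NumberTheory.LFunctions.HalaszRestricted
import HarnessLib

/-!
# Node weights of `ζ`-mollified combs, X: the diagonal of the two-point design `δ₁ + δ_p`

Topic `Literature/NumberTheory/LFunctions`.  For the resonator `α = δ₁ + δ_p` (`p` prime) the
four pairs `(ℓ, ℓ') ∈ {1, p}²` have diagonal counts `D_{ℓℓ'}(n) = ∑_{k' ≤ Y/(nℓ')} 𝟙[ℓ ∣ nℓ'k']/k'`
(`Y = 1/(4h)`):  for `(1,1), (1,p), (p,p)` the divisibility is automatic and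
`∑_n ((c-Λ)(n)/n) D(n) = O(T₀ log Y)` by exchange of summation; for `(p, 1)` the count is
`(1/p)H(⌊Y/(np)⌋) + 𝟙[p ∣ n](H(⌊Y/n⌋) - (1/p)H(⌊Y/(np)⌋))`, whose second part against `c ≥ 0` is
the DIVERGENT quantity `≥ (log Y/4) ∑_{n ≤ √Y, p ∣ n} c(n)/n` and against `Λ` is `O(log Y)`:

* `diag_trivial_bound` — `|∑_n (d(n)/n) H(⌊X/n⌋')| ≤ T₀(1 + log Y)` for `X = Y/ℓ' ≥ 1`
  (the pairs with `ℓ ∣ nℓ'k'` automatic);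
* `diag_p1_decomp` — the decomposition of `D_{p1}`;
* `hero_lower_bound` — `∑_n (c(n)/n)𝟙[p∣n](H(⌊Y/n⌋) - H(⌊Y/(np)⌋)/p) ≥ (log Y/4)∑_{n≤√Y, p∣n} c(n)/n`;
* `vonMangoldt_part_le` — the same against `Λ` is `≤ 2(1 + log Y)`.

Everything is proved; no named facts.
-/

noncomputable section

open MeasureTheory Set
open scoped ArithmeticFunction.vonMangoldt

namespace Literature.NumberTheory.LFunctions

/-! ## The pairs with automatic divisibility -/

/-- For `X = Y/ℓ'` (`Y = 1/(4h)`): `⌊Y/(nℓ')⌋ = ⌊X/n⌋`. [folklore] -/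
theorem floor_Y_div (h : ℝ) (n ℓ' : ℕ) :
    ⌊1 / (4 * h) / ((n : ℝ) * ℓ')⌋₊ = ⌊1 / (4 * h) / (ℓ' : ℝ) / n⌋₊ := by
  rw [div_div (1 / (4 * h)) (ℓ' : ℝ) n, mul_comm (ℓ' : ℝ) n]

/-- **Trivial-divisibility diagonal**: `|∑_{n ≤ N} (d(n)/n) ∑_{k' ≤ ⌊Y/(nℓ')⌋} 1/k'| ≤ T₀(1 + log(Y/ℓ'))`
for `Y/ℓ' ≥ 1`, `|∑_{n ≤ N} d(n)/n| ≤ T₀`. [folklore] -/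
theorem diag_trivial_bound {d : ℕ → ℝ} {T₀ h : ℝ} {ℓ' : ℕ}
    (hT : ∀ N : ℕ, |∑ n ∈ Finset.Icc 1 N, d n / n| ≤ T₀) (hX : 1 ≤ 1 / (4 * h) / (ℓ' : ℝ)) (N : ℕ) :
    |∑ n ∈ Finset.Icc 1 N, d n / n * ∑ k' ∈ Finset.Icc 1 ⌊1 / (4 * h) / ((n : ℝ) * ℓ')⌋₊, (1 : ℝ) / k'|
      ≤ T₀ * (1 + Real.log (1 / (4 * h) / (ℓ' : ℝ))) := by
  simp_rw [floor_Y_div h _ ℓ']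
  exact abs_sum_div_mul_harmonic_floor_le hT hX N

/-! ## The pair `(p, 1)` -/

/-- **Decomposition of `D_{p1}`** (`p` prime): with `K = ⌊Y/n⌋`,
`∑_{k' ≤ K} 𝟙[p ∣ nk']/k' = (1/p)H(K/p) + 𝟙[p ∣ n](H(K) - (1/p)H(K/p))`. [folklore] -/
theorem diag_p1_decomp {p : ℕ} (hp : p.Prime) (n K : ℕ) :
    ∑ k' ∈ Finset.Icc 1 K, (if p ∣ n * 1 * k' then (1 : ℝ) / k' else 0)
      = 1 / (p : ℝ) * ∑ j ∈ Finset.Icc 1 (K / p), (1 : ℝ) / j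
        + (if p ∣ n then
            ∑ k' ∈ Finset.Icc 1 K, (1 : ℝ) / k' - 1 / (p : ℝ) * ∑ j ∈ Finset.Icc 1 (K / p), (1 : ℝ) / j
          else 0) := by
  by_cases hpn : p ∣ n
  · rw [if_pos hpn]
    have : ∀ k' : ℕ, p ∣ n * 1 * k' := fun k' ↦ by
      rw [mul_one]; exact dvd_mul_of_dvd_left hpn k'
    simp only [this, if_true]
    ring
  · rw [if_neg hpn, add_zero]
    have hiff : ∀ k' : ℕ, (p ∣ n * 1 * k' ↔ p ∣ k') := fun k' ↦ by
      rw [mul_one, hp.dvd_mul]; exact ⟨fun h ↦ h.resolve_left hpn, Or.inr⟩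
    simp only [hiff]
    exact sum_ite_dvd_inv_eq hp.one_lt.le K

/-- `⌊Y/n⌋/p = ⌊(Y/p)/n⌋` as natural numbers. [folklore] -/
theorem floor_div_p (Y : ℝ) (n p : ℕ) : ⌊Y / n⌋₊ / p = ⌊Y / (p : ℝ) / n⌋₊ := by
  rw [← Nat.floor_div_natCast, div_right_comm]

/-- **The divergent term from below.** For `c ≥ 0`, `p ≥ 2`, `Y ≥ 1` and `⌊√Y⌋ ≤ N`:
`∑_{n ≤ N} (c(n)/n) 𝟙[p ∣ n](H(⌊Y/n⌋) - (1/p)H(⌊Y/n⌋/p)) ≥ (log Y / 4) ∑_{n ≤ ⌊√Y⌋, p ∣ n} c(n)/n`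
(`H(⌊Y/n⌋/p) ≤ H(⌊Y/n⌋)`, `1 - 1/p ≥ 1/2`, and `H(⌊Y/n⌋) ≥ log(Y/n) ≥ (log Y)/2` for `n ≤ √Y`).
[folklore] -/
theorem hero_lower_bound {c : ℕ → ℝ} (hc0 : ∀ n, 0 ≤ c n) {p : ℕ} (hp : 2 ≤ p) {Y : ℝ} (hY : 1 ≤ Y)
    {N : ℕ} (hN : ⌊Real.sqrt Y⌋₊ ≤ N) :
    Real.log Y / 4 * ∑ n ∈ Finset.Icc 1 ⌊Real.sqrt Y⌋₊, (if p ∣ n then c n / n else 0)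
      ≤ ∑ n ∈ Finset.Icc 1 N, c n / n *
          (if p ∣ n then
            ∑ k' ∈ Finset.Icc 1 ⌊Y / n⌋₊, (1 : ℝ) / k'
              - 1 / (p : ℝ) * ∑ j ∈ Finset.Icc 1 (⌊Y / n⌋₊ / p), (1 : ℝ) / j
          else 0) := by
  have hpR : (2 : ℝ) ≤ p := by exact_mod_cast hp
  have hp0 : (0 : ℝ) < p := by linarith
  have hY0 : 0 < Y := by linarith
  have hlogY : 0 ≤ Real.log Y := Real.log_nonneg hY
  -- termwise lower bound on `n ≤ N`
  set T : ℕ → ℝ := fun n ↦ c n / n *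
    (if p ∣ n then ∑ k' ∈ Finset.Icc 1 ⌊Y / n⌋₊, (1 : ℝ) / k'
        - 1 / (p : ℝ) * ∑ j ∈ Finset.Icc 1 (⌊Y / n⌋₊ / p), (1 : ℝ) / j else 0) with hT
  have hH0 : ∀ m : ℕ, 0 ≤ ∑ k' ∈ Finset.Icc 1 m, (1 : ℝ) / k' :=
    fun m ↦ Finset.sum_nonneg fun k _ ↦ by positivity
  have hHmono : ∀ m : ℕ, ∑ j ∈ Finset.Icc 1 (m / p), (1 : ℝ) / j ≤ ∑ k' ∈ Finset.Icc 1 m, (1 : ℝ) / k' :=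
    fun m ↦ Finset.sum_le_sum_of_subset_of_nonneg (Finset.Icc_subset_Icc le_rfl (Nat.div_le_self m p))
      fun k _ _ ↦ by positivity
  have hbr : ∀ n : ℕ, 1 ≤ n → p ∣ n →
      1 / 2 * ∑ k' ∈ Finset.Icc 1 ⌊Y / n⌋₊, (1 : ℝ) / k'
        ≤ ∑ k' ∈ Finset.Icc 1 ⌊Y / n⌋₊, (1 : ℝ) / k'
            - 1 / (p : ℝ) * ∑ j ∈ Finset.Icc 1 (⌊Y / n⌋₊ / p), (1 : ℝ) / j := by
    intro n _ _
    have h1 : 1 / (p : ℝ) * ∑ j ∈ Finset.Icc 1 (⌊Y / n⌋₊ / p), (1 : ℝ) / j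
        ≤ 1 / 2 * ∑ k' ∈ Finset.Icc 1 ⌊Y / n⌋₊, (1 : ℝ) / k' := by
      have : 1 / (p : ℝ) ≤ 1 / 2 := one_div_le_one_div_of_le (by norm_num) hpR
      exact mul_le_mul this (hHmono _) (hH0 _) (by norm_num)
    linarith
  have hTnonneg : ∀ n ∈ Finset.Icc 1 N, 0 ≤ T n := by
    intro n hn
    have hn1 := (Finset.mem_Icc.1 hn).1
    simp only [hT]
    split_ifs with hpn
    · have := hbr n hn1 hpn
      have h0 := hH0 ⌊Y / n⌋₊
      exact mul_nonneg (div_nonneg (hc0 n) (Nat.cast_nonneg n)) (by linarith)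
    · rw [mul_zero]
  -- restrict to `n ≤ ⌊√Y⌋`
  have hsub : Finset.Icc 1 ⌊Real.sqrt Y⌋₊ ⊆ Finset.Icc 1 N := Finset.Icc_subset_Icc le_rfl hN
  have hrestr : ∑ n ∈ Finset.Icc 1 ⌊Real.sqrt Y⌋₊, T n ≤ ∑ n ∈ Finset.Icc 1 N, T n :=
    Finset.sum_le_sum_of_subset_of_nonneg hsub fun n hn _ ↦ hTnonneg n hn
  refine le_trans ?_ hrestr
  rw [Finset.mul_sum]
  refine Finset.sum_le_sum fun n hn ↦ ?_
  obtain ⟨hn1, hnY⟩ := Finset.mem_Icc.1 hn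
  have hn0 : (0 : ℝ) < n := by exact_mod_cast hn1
  simp only [hT]
  split_ifs with hpn
  · -- `H(⌊Y/n⌋) ≥ log(Y/n) ≥ log Y / 2`
    have hnsq : (n : ℝ) ≤ Real.sqrt Y := le_trans (by exact_mod_cast hnY) (Nat.floor_le (Real.sqrt_nonneg _))
    have hlogn : Real.log n ≤ Real.log Y / 2 := by
      have := Real.log_le_log hn0 hnsq
      rwa [Real.log_sqrt hY0.le] at this
    have hH : Real.log Y / 2 ≤ ∑ k' ∈ Finset.Icc 1 ⌊Y / n⌋₊, (1 : ℝ) / k' := by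
      have h1 := log_le_sum_inv_Icc_floor (x := Y / n) (by positivity)
      rw [Real.log_div hY0.ne' hn0.ne'] at h1
      linarith
    have hb := hbr n hn1 hpn
    have hcn : 0 ≤ c n / n := div_nonneg (hc0 n) hn0.le
    calc Real.log Y / 4 * (c n / n) = c n / n * (1 / 2 * (Real.log Y / 2)) := by ring
      _ ≤ c n / n * (1 / 2 * ∑ k' ∈ Finset.Icc 1 ⌊Y / n⌋₊, (1 : ℝ) / k') :=
          mul_le_mul_of_nonneg_left (mul_le_mul_of_nonneg_left hH (by norm_num)) hcn
      _ ≤ _ := mul_le_mul_of_nonneg_left hb hcn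
  · simp

/-- **The same term against `Λ` is small**: for `p` prime, `Y ≥ 1`,
`∑_{n ≤ N} (Λ(n)/n) 𝟙[p ∣ n](H(⌊Y/n⌋) - (1/p)H(⌊Y/n⌋/p)) ≤ 2(1 + log Y)`
(only `n = p^k` count, `∑_k Λ(p^k)/p^k ≤ 2 log p/p ≤ 2`). [folklore] -/
theorem vonMangoldt_part_le {p : ℕ} (hp : p.Prime) {Y : ℝ} (hY : 1 ≤ Y) (N : ℕ) :
    ∑ n ∈ Finset.Icc 1 N, (Λ n : ℝ) / n *
          (if p ∣ n then
            ∑ k' ∈ Finset.Icc 1 ⌊Y / n⌋₊, (1 : ℝ) / k'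
              - 1 / (p : ℝ) * ∑ j ∈ Finset.Icc 1 (⌊Y / n⌋₊ / p), (1 : ℝ) / j
          else 0)
      ≤ 2 * (1 + Real.log Y) := by
  have hp2 : (2 : ℝ) ≤ p := by exact_mod_cast hp.two_le
  have hp0 : (0 : ℝ) < p := by linarith
  have hY0 : 0 < Y := by linarith
  have hlogY : 0 ≤ Real.log Y := Real.log_nonneg hY
  have hH0 : ∀ m : ℕ, 0 ≤ ∑ k' ∈ Finset.Icc 1 m, (1 : ℝ) / k' :=
    fun m ↦ Finset.sum_nonneg fun k _ ↦ by positivity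
  -- bound each bracket by `1 + log Y`
  have hbr : ∀ n : ℕ, 1 ≤ n →
      ∑ k' ∈ Finset.Icc 1 ⌊Y / n⌋₊, (1 : ℝ) / k'
          - 1 / (p : ℝ) * ∑ j ∈ Finset.Icc 1 (⌊Y / n⌋₊ / p), (1 : ℝ) / j ≤ 1 + Real.log Y := by
    intro n hn
    have hn0 : (0 : ℝ) < n := by exact_mod_cast hn
    have h1 : ∑ k' ∈ Finset.Icc 1 ⌊Y / n⌋₊, (1 : ℝ) / k' ≤ 1 + Real.log Y := by
      have h2 := LevinsonSums.sum_Icc_one_div_le ⌊Y / n⌋₊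
      rcases Nat.eq_zero_or_pos ⌊Y / n⌋₊ with h0 | hpos
      · rw [h0]; simp; linarith
      · have h3 : Real.log (⌊Y / n⌋₊ : ℕ) ≤ Real.log Y := by
          apply Real.log_le_log (by exact_mod_cast hpos)
          exact (Nat.floor_le (by positivity)).trans (div_le_self hY0.le (by exact_mod_cast hn))
        linarith
    have h4 : 0 ≤ 1 / (p : ℝ) * ∑ j ∈ Finset.Icc 1 (⌊Y / n⌋₊ / p), (1 : ℝ) / j := by
      have := hH0 (⌊Y / n⌋₊ / p); positivity
    linarith
  calc ∑ n ∈ Finset.Icc 1 N, (Λ n : ℝ) / n *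
          (if p ∣ n then
            ∑ k' ∈ Finset.Icc 1 ⌊Y / n⌋₊, (1 : ℝ) / k'
              - 1 / (p : ℝ) * ∑ j ∈ Finset.Icc 1 (⌊Y / n⌋₊ / p), (1 : ℝ) / j
          else 0)
      ≤ ∑ n ∈ Finset.Icc 1 N, (if p ∣ n then (Λ n : ℝ) / n else 0) * (1 + Real.log Y) := by
        refine Finset.sum_le_sum fun n hn ↦ ?_
        have hn1 := (Finset.mem_Icc.1 hn).1
        have hΛn : 0 ≤ (Λ n : ℝ) / n := div_nonneg ArithmeticFunction.vonMangoldt_nonneg (Nat.cast_nonneg n)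
        split_ifs with hpn
        · exact mul_le_mul_of_nonneg_left (hbr n hn1) hΛn
        · simp
    _ = (∑ n ∈ (Finset.Icc 1 N).filter (p ∣ ·), (Λ n : ℝ) / n) * (1 + Real.log Y) := by
        rw [← Finset.sum_mul, Finset.sum_filter]
    _ ≤ (2 * Real.log p / p) * (1 + Real.log Y) :=
        mul_le_mul_of_nonneg_right (Halasz.Restricted.sum_vonMangoldt_div_filter_dvd_le hp N) (by linarith)
    _ ≤ 2 * (1 + Real.log Y) := by
        have hlp : Real.log p ≤ p := (Real.log_le_sub_one_of_pos hp0).trans (by linarith)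
        have : 2 * Real.log p / p ≤ 2 := by
          rw [div_le_iff₀ hp0]; linarith
        exact mul_le_mul_of_nonneg_right this (by linarith)

end Literature.NumberTheory.LFunctions
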